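import Literature.AlgebraicGeometry.HodgeTheory.DivisorInduction
import Literature.AlgebraicGeometry.HodgeTheory.ThomGysinClosedImmersion
import HarnessLib

/-!
# Route LimitExtension · `MiddleDivisorSupportSuffices` (stmt-HodgeConjecture-10865):
# the snc bridge, cohomology side — Prop. 8.2.7 for the components from the snc principle; padding

Cohomological half of the snc bridge (see `…SNCBridgeResolution.lean` for the scheme-theoretic
half and `…Modification.lean` for the consumer). The **snc principle of two types** — on a smooth
projective complex variety a class of `H^q(X(ℂ); ℂ)` restricting to zero on the complex points of
every member of an snc boundary (`Resolution.HasSNC`) vanishes on an open neighbourhood of their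
union; Deligne–Griffiths–Morgan–Sullivan 1975 §5–§6 / Griffiths–Schmid 1975 §4, i.e. Deligne's
Prop. 8.2.7 for the (smooth, normally crossing) members of the boundary, strictly weaker than the
named fact `Deligne1974_ker_pullback_eq_ker_pullback_resolution` (arbitrary families) — is turned
into Prop. 8.2.7 in Čech form for the family of closed immersions of the components, and such a
family is padded to dimension exactly `n` without changing images or the Čech statement. All
PROVED; no definitions, no named facts:

* `map_subsetIncl_eq_zero_of_complexBetti_map_eq_zero` — a class killed by the pull-back along a
  closed immersion vanishes on the complex points of the image (the embedding `g(ℂ)`);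
* `pullback827_of_snc` — Prop. 8.2.7 in Čech form for a family of closed immersions whose images
  are the supports of the members of an snc boundary, from the snc principle;
* `exists_padded_family` — padding by projective spaces (Brosnan–Fang–Nie–Pearlstein, Lemma 48):
  same images, same Čech statement, members of dimension exactly `n`.

## References

* [DeligneGriffithsMorganSullivan1975] P. Deligne, P. Griffiths, J. Morgan, D. Sullivan, Real
  homotopy theory of Kähler manifolds, Invent. Math. 29 (1975), §5–§6.
* [DeligneHodgeIII1974] P. Deligne, Théorie de Hodge III, Publ. Math. IHÉS 44 (1974), Prop. 8.2.7.
* [BrosnanFangNiePearlstein2009] P. Brosnan, H. Fang, Z. Nie, G. Pearlstein, Singularities of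
  admissible normal functions, Invent. Math. 177 (2009), §6 Lemma 48.
* [SerreGAGA1956] J.-P. Serre, GAGA, Ann. Inst. Fourier 6 (1956), §2.
-/

-- `Summit.HodgeConjecture.HodgeConjecture.Theorems` is the mandated namespace (single-conjunct summit:
-- Sub = Summit), which `linter.dupNamespace` flags; off tree-wide in the lakefile, restated here so
-- stand-alone elaboration is warning-free too.
set_option linter.dupNamespace false

noncomputable section

open CategoryTheory CategoryTheory.Limits AlgebraicGeometry TopologicalSpace
open MonoidalCategory CartesianMonoidalCategory
open Literature.AlgebraicTopology.SingularHomology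
open Literature.AlgebraicGeometry.Resolution Literature.AlgebraicGeometry.Motives
open Literature.AlgebraicGeometry.HodgeTheory

namespace Summit.HodgeConjecture.HodgeConjecture.Theorems

universe u

/-! ### Step D: Prop. 8.2.7 for the family of components, from the snc principle of two types -/

/-- **A class killed by the pull-back along a closed immersion vanishes on (the complex points of)
its image**: `g(ℂ)` is an embedding with image `{Q | pt Q ∈ g(Y)}`
(`AlgPoints.isEmbedding_map_of_isClosedImmersion`, `range_map_eq_setOf_pt_mem_range`), so the
restriction to that subset factors through `g(ℂ)^*` up to a homeomorphism.
[cite: SerreGAGA1956, §2] -/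
theorem map_subsetIncl_eq_zero_of_complexBetti_map_eq_zero {X' Y : SchemeOver ℂ} (g : Y ⟶ X')
    [IsClosedImmersion g.left] {q : ℕ} {x' : complexBetti X' q}
    (hx : complexBetti.map g q x' = 0) {S : Set X'.left} (hS : S = Set.range g.left.base) :
    singularCohomology.map ℂ ℂ (subsetIncl {Q : ComplexPoints X' | Q.pt ∈ S}) q x' = 0 := by
  subst hS
  have hemb := AlgPoints.isEmbedding_map_of_isClosedImmersion (L := ℂ) g
  have hrange : Set.range (AlgPoints.map (L := ℂ) g) =
      {P : ComplexPoints X' | P.pt ∈ Set.range g.left.base} :=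
    range_map_eq_setOf_pt_mem_range (L := ℂ) g
  let e : ComplexPoints Y ≃ₜ ↥({P : ComplexPoints X' | P.pt ∈ Set.range g.left.base}) :=
    hemb.toHomeomorph.trans (Homeomorph.setCongr hrange)
  have hinj : Function.Injective (singularCohomology.map ℂ ℂ
      (e : C(ComplexPoints Y, ↥({P : ComplexPoints X' | P.pt ∈ Set.range g.left.base}))) q) :=
    ((forget (ModuleCat ℂ)).mapIso (singularCohomology.mapIso ℂ ℂ e q)).toEquiv.injective
  apply hinj
  rw [map_zero, ← ModuleCat.comp_apply, ← singularCohomology.map_comp]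
  have hc : (subsetIncl {P : ComplexPoints X' | P.pt ∈ Set.range g.left.base}).comp
      (e : C(ComplexPoints Y, ↥({P : ComplexPoints X' | P.pt ∈ Set.range g.left.base}))) =
      AlgPoints.mapContinuous (L := ℂ) g := by
    ext P
    rfl
  rw [hc]
  exact hx

/-- **Prop. 8.2.7 in Čech form for the family of components of an snc boundary, from the snc
principle of two types.** If on the smooth projective `X'` every class restricting to zero on the
(complex points of the) members of an snc boundary vanishes near their union (the principle of two
types, Deligne–Griffiths–Morgan–Sullivan §5–§6 / Griffiths–Schmid §4, the snc case of Deligne's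
Prop. 8.2.7 — hypothesis `hS`), then for every finite family of closed immersions `g i` whose
images are exactly the supports of the members of such a boundary `Es`, a class killed by all
`(g i)(ℂ)^*` vanishes on an open neighbourhood of `{Q | pt Q ∈ ⋃ i, g_i(Y i)}`.
[cite: DeligneGriffithsMorganSullivan1975, §5–§6] [cite: DeligneHodgeIII1974, Prop. 8.2.7] -/
theorem pullback827_of_snc {X' : SchemeOver ℂ}
    (hS : ∀ (E : List X'.left.IdealSheafData), HasSNC E → ∀ (q : ℕ) (x' : complexBetti X' q),
      (∀ D ∈ E, singularCohomology.map ℂ ℂ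
        (subsetIncl {Q : ComplexPoints X' | Q.pt ∈ ((D.support : Set X'.left))}) q x' = 0) →
      ∃ V : Set (ComplexPoints X'), IsOpen V ∧
        {Q : ComplexPoints X' | Q.pt ∈ ⋃ D ∈ E, ((D.support : Set X'.left))} ⊆ V ∧
        singularCohomology.map ℂ ℂ (subsetIncl V) q x' = 0)
    (Es : List X'.left.IdealSheafData) (hEs : HasSNC Es)
    {ι : Type} {Y : ι → SchemeOver ℂ} (g : ∀ i, Y i ⟶ X') (hg : ∀ i, IsClosedImmersion (g i).left)
    (h1 : ∀ P ∈ Es, ∃ i, ((P.support : Set X'.left)) = Set.range (g i).left.base)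
    (h2 : ∀ i, ∃ P ∈ Es, ((P.support : Set X'.left)) = Set.range (g i).left.base) :
    ∀ (q : ℕ) (x' : complexBetti X' q), (∀ i, complexBetti.map (g i) q x' = 0) →
      ∃ V : Set (ComplexPoints X'), IsOpen V ∧
        {P | P.pt ∈ ⋃ i, Set.range (g i).left.base} ⊆ V ∧
        singularCohomology.map ℂ ℂ (subsetIncl V) q x' = 0 := by
  intro q x' hx'
  obtain ⟨V, hV, hsub, hres⟩ := hS Es hEs q x' fun P hP => by
    obtain ⟨i, hi⟩ := h1 P hP
    haveI := hg i
    exact map_subsetIncl_eq_zero_of_complexBetti_map_eq_zero (g i) (hx' i) hi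
  refine ⟨V, hV, fun Q hQ => hsub ?_, hres⟩
  obtain ⟨i, hQi⟩ := Set.mem_iUnion.mp hQ
  obtain ⟨P, hP, hPi⟩ := h2 i
  exact Set.mem_biUnion hP (show Q.pt ∈ ((P.support : Set X'.left)) by rw [hPi]; exact hQi)

/-! ### Step E: padding the members to dimension exactly `n` -/

/-- **Padding a family by projective spaces** (Brosnan–Fang–Nie–Pearlstein, Lemma 48: "set
`X = Y × ℙ^{2k − dim Y}`", as in the tree's `exists_equidim_family_iUnion_range_eq`): a finite
family `g i : Y i ⟶ X'` from smooth projective varieties of dimensions `m i ≤ n` is replaced by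
`Y i × ℙ^{n − m i} ⟶ Y i ⟶ X'`, morphisms from `n`-folds with the same images (the first
projection is onto, `surjective_fst_left_base`) and the same Prop. 8.2.7 in Čech form (the first
projection has a section `sliceAt`, so `(g i)(ℂ)^*` and `(fst ≫ g i)(ℂ)^*` have the same kernel).
[cite: BrosnanFangNiePearlstein2009, §6 Lemma 48 (proof)] -/
theorem exists_padded_family {n : ℕ} {X' : SchemeOver ℂ}
    {ι : Type} {m : ι → ℕ} {Y : ι → SchemeOver ℂ}
    (hY : ∀ i, IsSmoothProjective (m i) (Y i)) (g : ∀ i, Y i ⟶ X') (hm : ∀ i, m i ≤ n)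
    (H : ∀ (q : ℕ) (x' : complexBetti X' q), (∀ i, complexBetti.map (g i) q x' = 0) →
      ∃ V : Set (ComplexPoints X'), IsOpen V ∧
        {P | P.pt ∈ ⋃ i, Set.range (g i).left.base} ⊆ V ∧
        singularCohomology.map ℂ ℂ (subsetIncl V) q x' = 0) :
    ∃ (E : ι → SchemeOver ℂ) (_ : ∀ i, IsSmoothProjective n (E i)) (e : ∀ i, E i ⟶ X'),
      (⋃ i, Set.range (e i).left.base) = ⋃ i, Set.range (g i).left.base ∧
      ∀ (q : ℕ) (x' : complexBetti X' q), (∀ i, complexBetti.map (e i) q x' = 0) →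
        ∃ V : Set (ComplexPoints X'), IsOpen V ∧
          {P | P.pt ∈ ⋃ i, Set.range (e i).left.base} ⊆ V ∧
          singularCohomology.map ℂ ℂ (subsetIncl V) q x' = 0 := by
  classical
  let P : ι → SchemeOver ℂ := fun i => projectiveSpace (n - m i) ℂ
  have hP : ∀ i, IsSmoothProjective (n - m i) (P i) := fun i =>
    isSmoothProjective_projectiveSpace_holds ℂ (n - m i)
  have hYP : ∀ i, IsSmoothProjective n (Y i ⊗ P i) := fun i => by
    have h := IsSmoothProjective.tensor_holds (hY i) (hP i)
    have e : m i + (n - m i) = n := by have := hm i; omega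
    rwa [e] at h
  -- a complex point of each `ℙ^{n - m i}`
  have ht : ∀ i, Nonempty (ComplexPoints (P i)) := fun i => by
    haveI := connectedSpace_complexPoints (hP i)
    infer_instance
  let t : ∀ i, ComplexPoints (P i) := fun i => (ht i).some
  have hrange : ∀ i, Set.range (fst (Y i) (P i) ≫ g i).left.base =
      Set.range (g i).left.base := fun i => by
    rw [Over.comp_left, Scheme.Hom.comp_base, TopCat.coe_comp, Set.range_comp,
      (surjective_fst_left_base (t i)).range_eq, Set.image_univ]
  refine ⟨fun i => Y i ⊗ P i, hYP, fun i => fst (Y i) (P i) ≫ g i,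
    Set.iUnion_congr hrange, fun q x' hx' => ?_⟩
  have hx : ∀ i, complexBetti.map (g i) q x' = 0 := fun i => by
    have hfac : g i = sliceAt (Y i) (t i) ≫
        (fst (Y i) (P i) ≫ g i) := by
      rw [← Category.assoc, sliceAt_fst, Category.id_comp]
    rw [hfac, complexBetti.map_comp, CategoryTheory.comp_apply, hx' i, map_zero]
  obtain ⟨V, hV, hsub, hres⟩ := H q x' hx
  refine ⟨V, hV, ?_, hres⟩
  rw [Set.iUnion_congr hrange]
  exact hsub

end Summit.HodgeConjecture.HodgeConjecture.Theorems

end
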